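import Summits.ValiantsHypothesis.ValiantsHypothesis.Theorems.BarrierLeverDefinableEquationsBoolSumComponents

/-!
# Crux `BarrierLever.DefinableEquations` (stmt-ValiantsHypothesis-8745) / `SingleSizeEquations`
# (8749) — TORUS WEIGHTS: torus stability of the crux's class, and one weight that separates
# degree and all coordinate weights (toolkit for the isobaric normal form, file
# `…DefinableEquationsIsobaric.lean`)

§1 TORUS STABILITY.  For `f ∈ SmallCircuits ℂ n b` and `t ∈ ℂ`, the torus translate
`t^{u₀} f(t^{u_1} x_1, …, t^{u_n} x_n)` lies in `SmallCircuits ℂ n (b+2)` (size `≤ L(f) + n + 1`,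
`complexity_aeval_le`; degree unchanged) and has coefficient vector `(t^{W m} coeff_m f)_m`,
`W m = u₀ + Σ_i u_i m_i` (`coeff_torusTranslate`).  Hence an equation at rung `b+2` vanishes on the
torus ORBIT of every `coeff f`, `f ∈ SmallCircuits ℂ n b`, and so do all its `W`-isobaric components
(`eval_component_eq_zero`, via the tree's `Isobaric.eval_weightedHomogeneousComponent_eq_zero`).

§2 DIGITS.  With `B` larger than `n ·` (every degree in sight) the single weight
`W m = B^n + Σ_i B^i m_i` has `weight_W(α) = Σ_i w_i(α) B^i + d(α) B^n` (`weight_combined`), the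
coordinate weights `w_i(α) = Σ_m α_m m_i ≤ n d(α)` (`weight_coord_le`) being the base-`B` digits;
base-`B` digits are unique (`digits_inj`), so a `W`-isobaric polynomial with small monomial degrees
is homogeneous and isobaric for every coordinate grading `c_m ↦ m_i` (`weightVector_of_combined`).

Elementary; no definitions, no named facts.  References: [Burgisser2000] Rem. 2.7;
[ForbesShpilkaVolk2018] Def. 1 (frame).
-/

-- layout Summits/ValiantsHypothesis/ValiantsHypothesis forces the duplicated namespace component
set_option linter.dupNamespace false

noncomputable section

open MvPolynomial

namespace Summit.ValiantsHypothesis.ValiantsHypothesis.Theorems.BarrierLever.IsobaricEquations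

open Literature.Computability.AlgebraicComplexity Literature.Barriers.ValiantsHypothesis
open Summit.ValiantsHypothesis.ValiantsHypothesis.Theorems.BarrierLever.SuccinctHittingSetsForVP
open Summit.ValiantsHypothesis.ValiantsHypothesis.Theorems.BarrierLever.BoolSumComponents

/-! ## §1 Torus stability of the crux's class -/

section torus

variable {n : ℕ}

/-- **Coefficients of a torus translate**: `coeff_m (t^{u₀} f(t^{u_i} x_i)) = t^{u₀ + Σ_i u_i m_i} coeff_m f`.
[folklore] -/
theorem coeff_torusTranslate (t : ℂ) (u₀ : ℕ) (u : Fin n → ℕ) (f : MvPolynomial (Fin n) ℂ)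
    (m : Fin n →₀ ℕ) :
    coeff m (C (t ^ u₀) * aeval (fun i => C (t ^ u i) * X i) f) =
      t ^ (u₀ + ∑ i, u i * m i) * coeff m f := by
  classical
  rw [coeff_C_mul, pow_add, mul_assoc]
  congr 1
  induction f using MvPolynomial.induction_on' with
  | monomial s a =>
    have hsum : ∑ i ∈ s.support, u i * s i = ∑ i, u i * s i :=
      Finset.sum_subset (Finset.subset_univ _) fun i _ hi => by
        rw [Finsupp.notMem_support_iff.mp hi, mul_zero]
    have h : aeval (fun i => (C (t ^ u i) * X i : MvPolynomial (Fin n) ℂ)) (monomial s a) =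
        monomial s (t ^ (∑ i, u i * s i) * a) := by
      rw [aeval_monomial, algebraMap_eq, Finsupp.prod]
      simp only [mul_pow, ← C_pow, ← pow_mul]
      rw [Finset.prod_mul_distrib, ← map_prod, Finset.prod_pow_eq_pow_sum, hsum,
        prod_X_pow_eq_monomial, C_mul_monomial, C_mul_monomial, mul_one, mul_comm]
    rw [h, coeff_monomial, coeff_monomial]
    split_ifs with hsm
    · subst hsm; rfl
    · rw [mul_zero]
  | add p q hp hq => rw [map_add, coeff_add, coeff_add, hp, hq, mul_add]

/-- Arithmetic: `n^b + n + 1 ≤ n^(b+2)` for `n ≥ 2`. [folklore] -/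
theorem torus_arith {b : ℕ} (hn : 2 ≤ n) : n ^ b + n + 1 ≤ n ^ (b + 2) := by
  have hsq : 2 * n ≤ n * n := Nat.mul_le_mul_right n hn
  rw [pow_add, pow_two]
  rcases Nat.eq_zero_or_pos b with rfl | hb
  · rw [pow_zero, one_mul]; omega
  · have hnb : n ≤ n ^ b := Nat.le_self_pow hb.ne' n
    have h4 : 4 * n ^ b ≤ n ^ b * (n * n) := by nlinarith
    omega

/-- **Torus translates of small circuits are small circuits** (two rungs up): for `n ≥ 2` and
`f ∈ SmallCircuits ℂ n b`, `t^{u₀} f(t^{u_i} x_i) ∈ SmallCircuits ℂ n (b + 2)` (size `≤ L(f) + n + 1`,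
degree unchanged). [cite: Burgisser2000, Rem. 2.7] -/
theorem torusTranslate_mem_smallCircuits (hn : 2 ≤ n) {b : ℕ} {f : MvPolynomial (Fin n) ℂ}
    (hf : f ∈ SmallCircuits ℂ n b) (t : ℂ) (u₀ : ℕ) (u : Fin n → ℕ) :
    C (t ^ u₀) * aeval (fun i => C (t ^ u i) * X i) f ∈ SmallCircuits ℂ n (b + 2) := by
  obtain ⟨hdeg, hL⟩ := hf
  refine ⟨?_, ?_⟩
  · refine (totalDegree_mul _ _).trans ?_
    rw [totalDegree_C, zero_add,
      show aeval (fun i => (C (t ^ u i) * X i : MvPolynomial (Fin n) ℂ)) f =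
        bind₁ (fun i => C (t ^ u i) * X i) f from rfl]
    refine (Literature.Barriers.ValiantsHypothesis.FSV2018.totalDegree_bind₁_le_mul _ 1
      (fun i => ?_) f).trans (by rw [mul_one]; exact hdeg)
    refine (totalDegree_mul _ _).trans ?_
    rw [totalDegree_C, totalDegree_X, zero_add]
  · have h1 : complexity (aeval (fun i => (C (t ^ u i) * X i : MvPolynomial (Fin n) ℂ)) f) ≤
        n ^ b + n := by
      refine (complexity_aeval_le _ _).trans (Nat.add_le_add hL ?_)
      calc ∑ i : Fin n, complexity (C (t ^ u i) * X i : MvPolynomial (Fin n) ℂ)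
          ≤ ∑ _i : Fin n, 1 := Finset.sum_le_sum fun i _ =>
            (complexity_mul_le_holds _ _).trans (by rw [complexity_C_holds, complexity_X_holds])
        _ = n := by simp
    calc complexity (C (t ^ u₀) * aeval (fun i => (C (t ^ u i) * X i : MvPolynomial (Fin n) ℂ)) f)
        ≤ complexity (C (t ^ u₀) : MvPolynomial (Fin n) ℂ) +
            complexity (aeval (fun i => (C (t ^ u i) * X i : MvPolynomial (Fin n) ℂ)) f) + 1 :=
          complexity_mul_le_holds _ _
      _ ≤ 0 + (n ^ b + n) + 1 := by rw [complexity_C_holds]; omega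
      _ ≤ n ^ (b + 2) := by rw [zero_add]; exact torus_arith hn

/-- **Isobaric components of an equation are equations** (two rungs down): if `E` vanishes at the
coefficient vector of every member of `SmallCircuits ℂ n (b+2)` (`n ≥ 2`), then for every weight of
torus type `W m = u₀ + Σ_i u_i m_i` every `W`-isobaric component of `E` vanishes at the coefficient
vector of every member of `SmallCircuits ℂ n b`. [folklore] -/
theorem eval_component_eq_zero (hn : 2 ≤ n) {b : ℕ} {E : MvPolynomial (degLEMonomials n) ℂ}
    (hE : ∀ f ∈ SmallCircuits ℂ n (b + 2), eval (coeffVector (degLEMonomials n) f) E = 0)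
    (u₀ : ℕ) (u : Fin n → ℕ) (J : ℕ) {f : MvPolynomial (Fin n) ℂ} (hf : f ∈ SmallCircuits ℂ n b) :
    eval (coeffVector (degLEMonomials n) f)
      (weightedHomogeneousComponent
        (fun m : degLEMonomials n => u₀ + ∑ i, u i * (m : Fin n →₀ ℕ) i) J E) = 0 := by
  refine Isobaric.eval_weightedHomogeneousComponent_eq_zero (fun t => ?_) J
  have hpt : (fun m : degLEMonomials n =>
        t ^ (u₀ + ∑ i, u i * (m : Fin n →₀ ℕ) i) * coeffVector (degLEMonomials n) f m) =
      coeffVector (degLEMonomials n) (C (t ^ u₀) * aeval (fun i => C (t ^ u i) * X i) f) := by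
    funext m
    rw [coeffVector_apply, coeffVector_apply, coeff_torusTranslate]
  rw [hpt]
  exact hE _ (torusTranslate_mem_smallCircuits hn hf t u₀ u)

end torus

/-! ## §2 Base-`B` digits: one weight separates degree and all coordinate weights -/

section digits

/-- Base-`B` representations with digits `< B` are unique (the top digit unconstrained).
[folklore] -/
theorem digits_inj (B : ℕ) (hB : 0 < B) :
    ∀ (k : ℕ) (x y : Fin k → ℕ) (a c : ℕ), (∀ i, x i < B) → (∀ i, y i < B) →
      (∑ i, x i * B ^ (i : ℕ)) + a * B ^ k = (∑ i, y i * B ^ (i : ℕ)) + c * B ^ k →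
        x = y ∧ a = c
  | 0, x, y, a, c, _, _, h => by
    refine ⟨funext fun i => Fin.elim0 i, ?_⟩
    simpa using h
  | k + 1, x, y, a, c, hx, hy, h => by
    have ex : ∀ (z : Fin (k + 1) → ℕ) (d : ℕ),
        (∑ i, z i * B ^ (i : ℕ)) + d * B ^ (k + 1) =
          z 0 + B * ((∑ i : Fin k, z i.succ * B ^ (i : ℕ)) + d * B ^ k) := by
      intro z d
      rw [Fin.sum_univ_succ, Fin.val_zero, pow_zero, mul_one, mul_add, Finset.mul_sum, add_assoc]
      congr 1; congr 1
      · exact Finset.sum_congr rfl fun i _ => by rw [Fin.val_succ, pow_succ]; ring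
      · ring
    rw [ex, ex] at h
    have hmod : x 0 = y 0 := by
      have h' := congrArg (fun t => t % B) h
      simp only [Nat.add_mul_mod_self_left, Nat.mod_eq_of_lt (hx 0), Nat.mod_eq_of_lt (hy 0)] at h'
      exact h'
    rw [hmod] at h
    have hrest := Nat.eq_of_mul_eq_mul_left hB (Nat.add_left_cancel h)
    obtain ⟨hxy, hac⟩ := digits_inj B hB k (fun i => x i.succ) (fun i => y i.succ) a c
      (fun i => hx _) (fun i => hy _) hrest
    exact ⟨funext fun i => Fin.cases hmod (fun j => congrFun hxy j) i, hac⟩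

variable {n : ℕ}

/-- The weight of a monomial `α` in the coefficient variables for the combined weight
`W m = B^n + Σ_i B^i m_i`: `(Σ_i w_i(α) B^i) + d(α) B^n`, with `d(α) = Σ_m α_m` and
`w_i(α) = Σ_m α_m m_i` the coordinate weights. [folklore] -/
theorem weight_combined (B : ℕ) (α : degLEMonomials n →₀ ℕ) :
    Finsupp.weight (fun m : degLEMonomials n => B ^ n + ∑ i : Fin n, B ^ (i : ℕ) * (m : Fin n →₀ ℕ) i) α =
      (∑ i : Fin n, Finsupp.weight (fun m : degLEMonomials n => (m : Fin n →₀ ℕ) i) α * B ^ (i : ℕ)) +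
        α.degree * B ^ n := by
  classical
  simp only [Finsupp.weight_apply, Finsupp.sum, smul_eq_mul, Finsupp.degree_apply]
  have h1 : ∀ m ∈ α.support, α m * (B ^ n + ∑ i : Fin n, B ^ (i : ℕ) * (m : Fin n →₀ ℕ) i) =
      (∑ i : Fin n, α m * (m : Fin n →₀ ℕ) i * B ^ (i : ℕ)) + α m * B ^ n := fun m _ => by
    rw [mul_add, Finset.mul_sum, add_comm]
    congr 1
    exact Finset.sum_congr rfl fun i _ => by ring
  rw [Finset.sum_congr rfl h1, Finset.sum_add_distrib, Finset.sum_comm, Finset.sum_mul]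
  congr 1
  exact Finset.sum_congr rfl fun i _ => by rw [Finset.sum_mul]

/-- A coordinate weight of a monomial is at most `n` times its degree (`m_i ≤ |m| ≤ n`).
[folklore] -/
theorem weight_coord_le (i : Fin n) (α : degLEMonomials n →₀ ℕ) :
    Finsupp.weight (fun m : degLEMonomials n => (m : Fin n →₀ ℕ) i) α ≤ n * α.degree := by
  classical
  simp only [Finsupp.weight_apply, Finsupp.sum, smul_eq_mul, Finsupp.degree_apply, Finset.mul_sum]
  refine Finset.sum_le_sum fun m _ => ?_
  rw [mul_comm n]
  exact Nat.mul_le_mul_left _ (le_trans (Finsupp.le_degree i (m : Fin n →₀ ℕ)) m.2)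

/-- `weight 1 α = d(α)`. [folklore] -/
theorem weight_one_eq_degree (α : degLEMonomials n →₀ ℕ) :
    Finsupp.weight (1 : degLEMonomials n → ℕ) α = α.degree := by
  classical
  simp only [Finsupp.weight_apply, Finsupp.sum, Pi.one_apply, smul_eq_mul, mul_one,
    Finsupp.degree_apply]

/-- **One weight separates everything**: a polynomial `E'` isobaric for the combined weight
`W m = B^n + Σ_i B^i m_i`, all of whose monomials `α` have `n · d(α) < B` and `d(α) < B`, is
homogeneous and isobaric for every coordinate grading. [folklore] -/
theorem weightVector_of_combined {B J : ℕ} (hB : 0 < B) {E' : MvPolynomial (degLEMonomials n) ℂ}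
    (hiso : IsWeightedHomogeneous
      (fun m : degLEMonomials n => B ^ n + ∑ i : Fin n, B ^ (i : ℕ) * (m : Fin n →₀ ℕ) i) E' J)
    (hsmall : ∀ α ∈ E'.support, n * α.degree < B ∧ α.degree < B) (hE' : E' ≠ 0) :
    ∃ (d : ℕ) (w : Fin n → ℕ), E'.IsHomogeneous d ∧
      ∀ i : Fin n, IsWeightedHomogeneous (fun m : degLEMonomials n => (m : Fin n →₀ ℕ) i) E' (w i) := by
  classical
  obtain ⟨α₀, hα₀⟩ := Finset.nonempty_iff_ne_empty.2 (support_eq_empty.not.2 hE')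
  have main : ∀ α : degLEMonomials n →₀ ℕ, coeff α E' ≠ 0 →
      (fun i : Fin n => Finsupp.weight (fun m : degLEMonomials n => (m : Fin n →₀ ℕ) i) α) =
        (fun i : Fin n => Finsupp.weight (fun m : degLEMonomials n => (m : Fin n →₀ ℕ) i) α₀) ∧
      α.degree = α₀.degree := by
    intro α hα
    have hαs : α ∈ E'.support := mem_support_iff.2 hα
    have key := (hiso hα).trans (hiso (mem_support_iff.1 hα₀)).symm
    rw [weight_combined, weight_combined] at key
    exact digits_inj B hB n _ _ _ _
      (fun i => lt_of_le_of_lt (weight_coord_le i α) (hsmall α hαs).1)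
      (fun i => lt_of_le_of_lt (weight_coord_le i α₀) (hsmall α₀ hα₀).1) key
  refine ⟨α₀.degree, fun i => Finsupp.weight (fun m : degLEMonomials n => (m : Fin n →₀ ℕ) i) α₀,
    ?_, fun i => ?_⟩
  · intro α hα
    rw [weight_one_eq_degree]
    exact (main α hα).2
  · intro α hα
    exact congrFun (main α hα).1 i

end digits

end Summit.ValiantsHypothesis.ValiantsHypothesis.Theorems.BarrierLever.IsobaricEquations

end
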